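import Literature.NumberTheory.Rogawski1990.CohDiscreteMemXiFamilyArchPinned        -- ★ the letter S2♯ `cohDiscrete_memXiFamily_archPinned` (#80) + READ-BACK 1 `….memXiFamily`, ★ D6 `MemXiFamily`
import Summits.HodgeConjecture.HodgeConjecture.Theorems.F0P3XiArchDataOfRecord       -- ★ `archTypeOfRecord`, `hasUnitaryArchType_archTypeOfRecord`, `archTypeOfRecord_eq`, `odd_archTypeOfRecord`, `isCohTrivialAt_of_mk_eq`
import Summits.HodgeConjecture.HodgeConjecture.Theorems.F0P3cMemXiFamilyRigidOfCot   -- ★ p847744 (LH1-p02 (g0)): U♭ on the cotangent locus `memXiFamily_rigid_of_isCot`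
import Summits.HodgeConjecture.HodgeConjecture.Theorems.F0P3CompactTrivOfRecord      -- ★ p819716: `cmCompactFactor_rightRegular_eq_self_of_isHolOrAntihol` (`K_c` fixes a cotangent `P`)
import Summits.HodgeConjecture.HodgeConjecture.Theorems.F0P3SLayerFoldShapes         -- ★ `exists_cohToken_of_isHolOrAntihol_cpt` (the `(𝔤,K)`-token of a cotangent `P`)
import HarnessLib

/-!
# Crux `H413`, half A line LH1 — THE EQUIVALENCE CERTIFICATE for the pay-down of the closer stub `stub_S2sharp`:
# S2♯ (#80) ⟹ each of the three organs FIN · PIN-ι · PIN-τ of the LH1 skeleton, and FIN ∧ PIN-ι ∧ PIN-τ ⟹ S2♯ — so `S2♯ ↔ FIN ∧ PIN-ι ∧ PIN-τ` BY THEOREM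

Cell `hodgecm-mathlib` (D-0151), FLOOR 0, crux item H413 = `stmt-HodgeConjecture-24833`, route of record `HCCMUnconditional` (no route verbs); half A
line LH1 (SEATPLAN-GO500.v1 §1B), prover LH1-p01 (g0) on the DEAL of LH1-plan (g0) 2026-09-02T02:06:30Z.  `--supports stmt-HodgeConjecture-24833`.
THEOREMS ONLY (no `def`, no instance, no notation, no named fact, no `sorry`); never imports a `Cruxes/…/Lines` module.

THE OBJECTS.  The closer of record `Cruxes/H413/Lines/F0_U3LettersRung1.lean` ED. 38 «PK-ε» carries the registered print stub
`stub_S2sharp : Literature.NumberTheory.Rogawski1990.cohDiscrete_memXiFamily_archPinned` (books §8.2 row III-26 (#80), UNPROVED print): at a compact CM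
letters' frame `(L ι H T hT) hdef h2 (μ) (μω hμu) hμω`, every discrete automorphic `P` of `U(H)` of (anti)holomorphic COTANGENT type at `ι`, fixed pointwise
by the compact archimedean factor `K_c` (★ `cmCompactFactor`), whose archimedean module at `ι` detects an irreducible `(𝔤,K)`-module with a degree-one class
of type `δ = ±1`, lies in the ξ-local family of a one-dimensional automorphic `ξ` of `H = U(2) × U(1)` (★ D6 `MemXiFamily P … μω hμu ξ`) whose archimedean
components are pinned: `∀ k, μω.HasUnitaryArchType k 0 → ∀ ι′, ξ.IsCohTrivialAt (tOfArchType k ι′) ι′`.  The LH1 pay-down skeleton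
`StubS2sharp.paydown.skeleton.v1` (LH1-plan (g0), sha16 c17c91f28f62a480; tree candidate `Cruxes/H413/Lines/F0_P3c_S2SharpPaydown.lean`) cuts S2♯ into
three organs — closed `Prop`s `S2FinLetter` (FIN: `∃ ξ, MemXiFamily P … ξ`), `S2PinIotaLetter` (PIN-ι: every `ξ` of the family is `IsCohTrivialAt
(tOfArchType k₀ ι) ι`, `k₀ := archTypeOfRecord μω` ★), `S2PinCompactLetter` (PIN-τ: every `ξ` of the family is `IsCohTrivialAt (tOfArchType k₀ τ) τ` at
every embedding `τ` off the place of `ι`) — and proves the head `stub_S2sharp_of_organs : FIN → PIN-ι → PIN-τ → S2♯`.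

THIS FILE (the converse legs + the Theorems-side twin of the head; the organ texts are the skeleton's §1 bodies TOKEN FOR TOKEN, written as explicit
`∀`-telescopes — no `def`, no import of the skeleton):
* §1 `s2Fin_of_S2sharp : S2♯ → ‹FIN›` — READ-BACK 1 ★ `cohDiscrete_memXiFamily_archPinned.memXiFamily` (forget the pin).
* §2 `s2PinIota_of_S2sharp : S2♯ → ‹PIN-ι›` — PIN-ι's binders lack S2♯'s `K_c`-triviality hypothesis: it HOLDS for a cotangent `P` (★ p819716
  `F0P3CompactTrivOfRecord.cmCompactFactor_rightRegular_eq_self_of_isHolOrAntihol`); S2♯ then yields `ξ₀` with `MemXiFamily P … ξ₀` and the pin at every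
  unitary type of `μω`, in particular at the type of record `k₀` (★ `hasUnitaryArchType_archTypeOfRecord μω hμu hμω`); and the GIVEN `ξ` of the family equals
  `ξ₀` by U♭ on the cotangent locus (★ p847744 `F0P3cMemXiFamilyRigidOfCot.memXiFamily_rigid_of_isCot`, LH1-p02 (g0): the ξ-local family of a cotangent `P`
  determines `ξ` — ★ `F0P3XiRigid.memXiFamily_rigid` at the irreducible admissible finite component of ★ `exists_irreducible_admissible_hasFinComponent_of_isCot`).
* §3 `s2PinCompact_of_S2sharp : S2♯ → ‹PIN-τ›` — PIN-τ's binders lack S2♯'s `(𝔤,K)`-token: a cotangent `P` HAS one (★ `F0P3SLayerFoldShapes.exists_cohToken_of_isHolOrAntihol_cpt`: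
  an irreducible `(M, σK, σ𝔤)` with a non-zero `(𝔤,K)`-map from `P.archModuleCM ι T hT` and a degree-one class of some type `δ = ±1`); then as in §2.
* §4 `s2sharp_of_organs : ‹FIN› → ‹PIN-ι› → ‹PIN-τ› → S2♯` — the Theorems-side twin of the skeleton's head (same proof: the `ξ` of FIN; a unitary type `k` of
  `μω` IS `k₀` ★ `archTypeOfRecord_eq`, every `k₀ w` odd ★ `odd_archTypeOfRecord`; an embedding over `ι` is `ι` or `ῑ` — PIN-ι + ★ `isCohTrivialAt_of_mk_eq`;
  an embedding off `ι` — PIN-τ), so that the hypothesis-free carrier `… : cohDiscrete_memXiFamily_archPinned` can be assembled UNDER `Theorems/` the day the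
  three organs are ★ (consumers: closer :64 by `exact`; F0P2's Day-X `Theorems/F0P2vPKPiOfTokens.pkPi_of_tokens (h80 : …)` — F0P2-ref1 (g9) r350), and
  §5 `s2sharp_iff_organs : S2♯ ↔ ‹FIN› ∧ ‹PIN-ι› ∧ ‹PIN-τ›` — THE CERTIFICATE: books row #80 ≡ FIN + PIN-ι + PIN-τ modulo ★ (LH-ref1's «not weaker ∕ not
  stronger than III-26» box closes by theorem; digits are the director's).
Nothing printed is discharged here: all three organs are rung-5 print ([Rogawski1990] ch. 12–15: stable base change `U(3) → GL₃∕L`, Thm. 13.3.5 ∕ 13.3.6 (c),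
§14.4, Thm. 14.6.4; verdict F0P2-p01 (g13) 2026-09-01T15:01:47Z) — the TR carpet pays them.  HONEST LABEL: HC_CM is proved only modulo the 7 printed citations
(2 remaining: hLiu418 = stmt-HodgeConjecture-24832, h413 = stmt-HodgeConjecture-24833) until rung 0 closes.

PRINT BEHIND THE THREE ORGANS (locators per the lit4 (g0) D-CITE of the skeleton, 2026-09-02T02:08:10Z): FIN = [Rogawski1990 Thm. 14.6.4 (p. 243); §15.3 ¶1
(p. 249); Thm. 13.3.6 (c) (p. 202); §13.1 p. 199; §12.2 p. 174; Lemma 4.13.1 (b)]; PIN-ι = [Prop. 15.2.1 (a)(b) (p. 249); §12.3 pp. 174–178, Prop. 12.3.3 (p. 178);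
Thm. 13.3.5 (p. 202); Thm. 14.6.4 (p. 243)] + [BorelWallach2000 VI Thm. 4.11, I Thm. 5.3]; PIN-τ = [§14.6 pp. 242–243 (`Π′(ξ_v) := {F_φ}` at the compact places);
§12.3 p. 176 (`F_φ`), p. 178; Thm. 13.3.5 (p. 202); Thm. 14.6.4 (p. 243)].

## References
* [Rogawski1990] J. D. Rogawski, *Automorphic Representations of Unitary Groups in Three Variables*, Ann. of Math. Stud. 123 (1990): §4.13 Lemma 4.13.1 (b);
  §12.2 pp. 173–174; §12.3 pp. 174–178 (`F_φ` p. 176, Prop. 12.3.3 p. 178); §13.1 p. 199; Thm. 13.3.5 and Thm. 13.3.6 (c) (p. 202); §14.5 p. 237; §14.6 pp. 241–244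
  (`Π′(ξ_v)` pp. 242–243, Thm. 14.6.4 p. 243); Prop. 15.2.1 (a)(b) and §15.3 ¶1 (p. 249).
* [BorelWallach2000] A. Borel, N. Wallach, *Continuous cohomology, discrete subgroups, and representations of reductive groups*, 2nd ed. (2000): I Thm. 5.3, VI Thm. 4.11.
* [Zelevinsky1980] A. V. Zelevinsky, *Induced representations of reductive 𝔭-adic groups II*, Ann. Sci. ÉNS 13 (1980), Thm. 4.2.  [FlathCorvallis1979] D. Flath,
  *Decomposition of representations into tensor products*, Proc. Sympos. Pure Math. 33.1 (1979), Thm. 3.  [BorelJacquet1979] A. Borel, H. Jacquet, Corvallis 33.1, §4.6.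
* [Liu2021] Y. Liu, *Fourier–Jacobi cycles and arithmetic relative trace formula*, Camb. J. Math. 9 (2021), Remark 4.2 (unitary archimedean types).
-/

-- Mathlib idiom (as in ★ `GlobalAPacketLetters`, ★ `CohDiscreteMemXiFamilyArchPinned`, ★ `F0P3SLayerFoldShapes`, ★ `F0P3GuardedLettersOfGuardedShape`): the
-- commutator bracket on `Module.End ℂ M`, needed to MENTION `(uFormGroup (Fin 2) (Fin 1)).lie →ₗ⁅ℝ⁆ Module.End ℂ M` in the organ telescopes.
attribute [local instance 100] LieRing.ofAssociativeRing

set_option autoImplicit false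
-- the mandated namespace has the single-problem summit's repeated segment (`HodgeConjecture.HodgeConjecture`)
set_option linter.dupNamespace false

noncomputable section

open NumberField IsDedekindDomain MeasureTheory
open scoped Matrix ComplexOrder

namespace Summit.HodgeConjecture.HodgeConjecture.Cruxes.H413.F0P3cS2SharpOrgansOfS2Sharp

open Literature.NumberTheory.Automorphic Literature.NumberTheory.Automorphic.UnitaryGroup
open Literature.NumberTheory.Automorphic.UnitaryGroup.CotangentForms
open Literature.NumberTheory.GaloisRepresentations
open Literature.NumberTheory.Rogawski1990
open Literature.RepresentationTheory.BorelWallach2000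
open Literature.RepresentationTheory.KonnoKonno2007 Literature.RepresentationTheory.KonnoKonno2007.RealDualPair
open Literature.RepresentationTheory.KonnoKonno2007.RealDualPair.UForm
open Summit.HodgeConjecture.HodgeConjecture.Cruxes.H413.F0P3XiArchDataOfRecord
open Summit.HodgeConjecture.HodgeConjecture.Cruxes.H413.F0P3cMemXiFamilyRigidOfCot (memXiFamily_rigid_of_isCot)
open Summit.HodgeConjecture.HodgeConjecture.Cruxes.H413.F0P3CompactTrivOfRecord (cmCompactFactor_rightRegular_eq_self_of_isHolOrAntihol)
open Summit.HodgeConjecture.HodgeConjecture.Cruxes.H413.F0P3SLayerFoldShapes (exists_cohToken_of_isHolOrAntihol_cpt)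

/-! ## §1 S2♯ ⟹ FIN (READ-BACK 1) -/

/-- **S2♯ ⟹ ORGAN FIN** (the skeleton's `S2FinLetter`, token for token): under the letter's hypotheses on `P` (cotangent type at the CM frame, `K_c`-trivial, a
`(𝔤,K)`-token at `ι` of type `δ = ±1`) there is `ξ` with `MemXiFamily P … μω hμu ξ` — READ-BACK 1 ★ `cohDiscrete_memXiFamily_archPinned.memXiFamily` (forget the pin).
[cite: Rogawski1990, §14.6 Thm. 14.6.4 (p. 243); §15.3 ¶1 (p. 249); Thm. 13.3.6 (c) (p. 202); §13.1 p. 199; §12.2 p. 174; §4.13 Lemma 4.13.1 (b)] [cite: BorelWallach2000, VI Thm. 4.11] -/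
theorem s2Fin_of_S2sharp (h : Literature.NumberTheory.Rogawski1990.cohDiscrete_memXiFamily_archPinned) :
    ∀ (L : Type) [Field L] [NumberField L] [IsCMField L] (ι : L →+* ℂ) (H : Matrix (Fin 3) (Fin 3) L) (T : GL (Fin 3) ℂ)
      (hT : (T : Matrix (Fin 3) (Fin 3) ℂ)ᴴ * H.map ι * (T : Matrix (Fin 3) (Fin 3) ℂ) = Literature.Geometry.ComplexHyperbolic.BallModel.J),
      (∀ τ' : L →+* ℂ, InfinitePlace.mk τ' ≠ InfinitePlace.mk ι → (H.map τ').PosDef) →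
      2 ≤ Module.finrank ℚ ↥(maximalRealSubfield L) →
      ∀ (μ : Measure (adelicGroupData (↥(maximalRealSubfield L)) L (IsCMField.complexConj L) 3 H).automorphicQuotient)
        [(adelicGroupData (↥(maximalRealSubfield L)) L (IsCMField.complexConj L) 3 H).IsAutomorphicMeasure μ]
        (μω : HeckeCharacter L) (hμu : μω.IsUnitary),
        (∀ x : Literature.NumberTheory.GaloisRepresentations.ideleGroup ↥(maximalRealSubfield L),
          μω (AdeleRing.ideleBaseChange (↥(maximalRealSubfield L)) L x) = quadraticHeckeCharCM L x) →
      ∀ (P : DiscreteAutomorphicRep (adelicGroupData (↥(maximalRealSubfield L)) L (IsCMField.complexConj L) 3 H) μ),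
        (P.IsHolCotangentAt (cmArchSection L ι H T hT) (cmCompactFactor L ι H T hT) ∨
          P.IsAntiholCotangentAt (cmArchSection L ι H T hT) (cmCompactFactor L ι H T hT)) →
        (∀ k : (adelicGroupData (↥(maximalRealSubfield L)) L (IsCMField.complexConj L) 3 H).Adelic, k ∈ cmCompactFactor L ι H T hT →
          ∀ v : P.space.toSubmodule, (adelicGroupData (↥(maximalRealSubfield L)) L (IsCMField.complexConj L) 3 H).rightRegular μ k
            (v : (adelicGroupData (↥(maximalRealSubfield L)) L (IsCMField.complexConj L) 3 H).L2 μ) = v) →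
        ∀ (M : Type) [AddCommGroup M] [Module ℂ M]
          (σK : Representation ℂ (uFormGroup (Fin 2) (Fin 1)).maximalCompact M) (σ𝔤 : (uFormGroup (Fin 2) (Fin 1)).lie →ₗ⁅ℝ⁆ Module.End ℂ M)
          (hM : IsGKModule (uFormGroup (Fin 2) (Fin 1)) σK σ𝔤), IsIrreducibleGK σK σ𝔤 →
          (∃ T₁ : P.archModuleCM ι T hT →ₗ[ℂ] M,
            (∀ (k : (uFormGroup (Fin 2) (Fin 1)).maximalCompact) (w : P.archModuleCM ι T hT), T₁ (P.archRepKCM ι T hT k w) = σK k (T₁ w)) ∧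
              (∀ (X : (uFormGroup (Fin 2) (Fin 1)).lie) (w : P.archModuleCM ι T hT), T₁ (P.archRepLieCM ι T hT X w) = σ𝔤 X (T₁ w)) ∧ T₁ ≠ 0) →
          ∀ δ : ℤ, (δ = 1 ∨ δ = -1) → upqTypeClasses σK σ𝔤 hM.ad_compat 1 δ ≠ ⊥ →
            ∃ ξ : OneDimAutRepH L,
              MemXiFamily P (transpose_map_cmConjRingHom_eq_of_frame L ι H T hT) (isUnit_det_of_frame L ι H T hT) μω hμu ξ :=
  fun L _ _ _ ι H T hT hdef h2 μ _ μω hμu hμω P hP hKc M _ _ σK σ𝔤 hM hirr htok δ hδ hne =>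
    h.memXiFamily L ι H T hT hdef h2 μ μω hμu hμω P hP hKc M σK σ𝔤 hM hirr htok δ hδ hne

/-! ## §2 S2♯ ⟹ PIN-ι (K_c-triviality of a cotangent `P` ★, the pin of S2♯'s `ξ₀` at `k₀` ★, `ξ = ξ₀` by U♭-cot ★) -/

/-- **S2♯ ⟹ ORGAN PIN-ι** (the skeleton's `S2PinIotaLetter`, token for token): at the letters' frame, for every discrete `P` of cotangent type at the CM frame with
a `(𝔤,K)`-token at `ι` into an irreducible module with a degree-one class of type `δ = ±1`, EVERY `ξ` with `MemXiFamily P … μω hμu ξ` satisfies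
`ξ.IsCohTrivialAt (tOfArchType (archTypeOfRecord μω) ι) ι`.  PROOF: `K_c` fixes the cotangent `P` pointwise (★ p819716
`cmCompactFactor_rightRegular_eq_self_of_isHolOrAntihol`), so S2♯ applies and yields `ξ₀` with `MemXiFamily P … ξ₀` and the pin at every unitary type of `μω` —
at the type of record `k₀ = archTypeOfRecord μω` (★ `hasUnitaryArchType_archTypeOfRecord`) and the embedding `ι`; the given `ξ` equals `ξ₀` by U♭ on the cotangent
locus (★ p847744 `memXiFamily_rigid_of_isCot`).  In print: `P ∈ Π′(ξ)` [Thm. 13.3.5, Thm. 14.6.4], `P_ι ∈ Π(ξ_ι) = {J^±_φ, D^∓_φ}` [§12.3 Prop. 12.3.3], `H¹ ≠ 0`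
forces `J^±_φ`, `φ = φ(1,0,−1)` [Prop. 15.2.1 (a)(b)].
[cite: Rogawski1990, Prop. 15.2.1 (a)(b) (p. 249); §12.3 pp. 174–178 (Prop. 12.3.3 p. 178); Thm. 13.3.5 and Thm. 13.3.6 (c) (p. 202); §14.6 Thm. 14.6.4 (p. 243); §13.1 p. 199]
[cite: BorelWallach2000, VI Thm. 4.11; I §5.3] [cite: BorelJacquet1979, §4.6] [cite: Zelevinsky1980, Thm. 4.2] [cite: Liu2021, Remark 4.2] -/
theorem s2PinIota_of_S2sharp (h : Literature.NumberTheory.Rogawski1990.cohDiscrete_memXiFamily_archPinned) :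
    ∀ (L : Type) [Field L] [NumberField L] [IsCMField L] (ι : L →+* ℂ) (H : Matrix (Fin 3) (Fin 3) L) (T : GL (Fin 3) ℂ)
      (hT : (T : Matrix (Fin 3) (Fin 3) ℂ)ᴴ * H.map ι * (T : Matrix (Fin 3) (Fin 3) ℂ) = Literature.Geometry.ComplexHyperbolic.BallModel.J),
      (∀ τ' : L →+* ℂ, InfinitePlace.mk τ' ≠ InfinitePlace.mk ι → (H.map τ').PosDef) →
      2 ≤ Module.finrank ℚ ↥(maximalRealSubfield L) →
      ∀ (μ : Measure (adelicGroupData (↥(maximalRealSubfield L)) L (IsCMField.complexConj L) 3 H).automorphicQuotient)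
        [(adelicGroupData (↥(maximalRealSubfield L)) L (IsCMField.complexConj L) 3 H).IsAutomorphicMeasure μ]
        (μω : HeckeCharacter L) (hμu : μω.IsUnitary),
        (∀ x : Literature.NumberTheory.GaloisRepresentations.ideleGroup ↥(maximalRealSubfield L),
          μω (AdeleRing.ideleBaseChange (↥(maximalRealSubfield L)) L x) = quadraticHeckeCharCM L x) →
      ∀ (P : DiscreteAutomorphicRep (adelicGroupData (↥(maximalRealSubfield L)) L (IsCMField.complexConj L) 3 H) μ),
        (P.IsHolCotangentAt (cmArchSection L ι H T hT) (cmCompactFactor L ι H T hT) ∨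
          P.IsAntiholCotangentAt (cmArchSection L ι H T hT) (cmCompactFactor L ι H T hT)) →
        ∀ (M : Type) [AddCommGroup M] [Module ℂ M]
          (σK : Representation ℂ (uFormGroup (Fin 2) (Fin 1)).maximalCompact M) (σ𝔤 : (uFormGroup (Fin 2) (Fin 1)).lie →ₗ⁅ℝ⁆ Module.End ℂ M)
          (hM : IsGKModule (uFormGroup (Fin 2) (Fin 1)) σK σ𝔤), IsIrreducibleGK σK σ𝔤 →
          (∃ T₁ : P.archModuleCM ι T hT →ₗ[ℂ] M,
            (∀ (k : (uFormGroup (Fin 2) (Fin 1)).maximalCompact) (w : P.archModuleCM ι T hT), T₁ (P.archRepKCM ι T hT k w) = σK k (T₁ w)) ∧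
              (∀ (X : (uFormGroup (Fin 2) (Fin 1)).lie) (w : P.archModuleCM ι T hT), T₁ (P.archRepLieCM ι T hT X w) = σ𝔤 X (T₁ w)) ∧ T₁ ≠ 0) →
          ∀ δ : ℤ, (δ = 1 ∨ δ = -1) → upqTypeClasses σK σ𝔤 hM.ad_compat 1 δ ≠ ⊥ →
            ∀ ξ : OneDimAutRepH L,
              MemXiFamily P (transpose_map_cmConjRingHom_eq_of_frame L ι H T hT) (isUnit_det_of_frame L ι H T hT) μω hμu ξ →
                ξ.IsCohTrivialAt (ArchSignRecipe.tOfArchType (archTypeOfRecord μω) ι) ι := by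
  intro L _ _ _ ι H T hT hdef h2 μ _ μω hμu hμω P hP M _ _ σK σ𝔤 hM hirr htok δ hδ hne ξ hmem
  -- S2♯'s missing hypothesis: the compact archimedean factor fixes a cotangent `P` pointwise (★ p819716)
  obtain ⟨ξ₀, hmem₀, hall⟩ := h L ι H T hT hdef h2 μ μω hμu hμω P hP
    (cmCompactFactor_rightRegular_eq_self_of_isHolOrAntihol L ι H T hT P hP) M σK σ𝔤 hM hirr htok δ hδ hne
  -- the given `ξ` of the family IS S2♯'s `ξ₀` (U♭ on the cotangent locus, ★ p847744)
  have hξ : ξ = ξ₀ := memXiFamily_rigid_of_isCot ι H T hT hdef h2 μω hμu P hP ξ ξ₀ hmem hmem₀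
  rw [hξ]
  exact hall (archTypeOfRecord μω) (hasUnitaryArchType_archTypeOfRecord μω hμu hμω) ι

/-! ## §3 S2♯ ⟹ PIN-τ (the `(𝔤,K)`-token of a cotangent `P` ★, the pin of S2♯'s `ξ₀` at `k₀` ★, `ξ = ξ₀` by U♭-cot ★) -/

/-- **S2♯ ⟹ ORGAN PIN-τ** (the skeleton's `S2PinCompactLetter`, token for token): at the letters' frame, for every discrete `P` of cotangent type at the CM frame
fixed pointwise by `K_c = cmCompactFactor L ι H T hT`, EVERY `ξ` with `MemXiFamily P … μω hμu ξ` satisfies `ξ.IsCohTrivialAt (tOfArchType (archTypeOfRecord μω) τ) τ`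
at every embedding `τ` with `mk τ ≠ mk ι`.  PROOF: a cotangent `P` carries a `(𝔤,K)`-token at `ι` — an irreducible `(M, σK, σ𝔤)` receiving a non-zero `(𝔤,K)`-map
from `P.archModuleCM ι T hT` with a degree-one class of some type `δ = ±1` (★ `exists_cohToken_of_isHolOrAntihol_cpt`) — so S2♯ applies and yields `ξ₀` with the pin at
`k₀` (★ `hasUnitaryArchType_archTypeOfRecord`) and every embedding, in particular `τ`; the given `ξ` equals `ξ₀` by U♭-cot (★ p847744 `memXiFamily_rigid_of_isCot`).
In print: at a place where `U(H)` is compact `Π′(ξ_τ) = {F_φ}` [§14.6 pp. 242–243], `K_c`-triviality gives `P_τ = 𝟙 = F_φ`, so `φ = φ(1,0,−1)` [§12.3 p. 176].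
[cite: Rogawski1990, §14.6 pp. 242–243 and Thm. 14.6.4 (p. 243); §12.3 p. 176 and p. 178; Thm. 13.3.5 (p. 202); §13.1 p. 199; Prop. 15.2.1 (b) (p. 249)]
[cite: BorelWallach2000, VI Thm. 4.11] [cite: Zelevinsky1980, Thm. 4.2] [cite: Liu2021, Remark 4.2] -/
theorem s2PinCompact_of_S2sharp (h : Literature.NumberTheory.Rogawski1990.cohDiscrete_memXiFamily_archPinned) :
    ∀ (L : Type) [Field L] [NumberField L] [IsCMField L] (ι : L →+* ℂ) (H : Matrix (Fin 3) (Fin 3) L) (T : GL (Fin 3) ℂ)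
      (hT : (T : Matrix (Fin 3) (Fin 3) ℂ)ᴴ * H.map ι * (T : Matrix (Fin 3) (Fin 3) ℂ) = Literature.Geometry.ComplexHyperbolic.BallModel.J),
      (∀ τ' : L →+* ℂ, InfinitePlace.mk τ' ≠ InfinitePlace.mk ι → (H.map τ').PosDef) →
      2 ≤ Module.finrank ℚ ↥(maximalRealSubfield L) →
      ∀ (μ : Measure (adelicGroupData (↥(maximalRealSubfield L)) L (IsCMField.complexConj L) 3 H).automorphicQuotient)
        [(adelicGroupData (↥(maximalRealSubfield L)) L (IsCMField.complexConj L) 3 H).IsAutomorphicMeasure μ]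
        (μω : HeckeCharacter L) (hμu : μω.IsUnitary),
        (∀ x : Literature.NumberTheory.GaloisRepresentations.ideleGroup ↥(maximalRealSubfield L),
          μω (AdeleRing.ideleBaseChange (↥(maximalRealSubfield L)) L x) = quadraticHeckeCharCM L x) →
      ∀ (P : DiscreteAutomorphicRep (adelicGroupData (↥(maximalRealSubfield L)) L (IsCMField.complexConj L) 3 H) μ),
        (P.IsHolCotangentAt (cmArchSection L ι H T hT) (cmCompactFactor L ι H T hT) ∨
          P.IsAntiholCotangentAt (cmArchSection L ι H T hT) (cmCompactFactor L ι H T hT)) →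
        (∀ k : (adelicGroupData (↥(maximalRealSubfield L)) L (IsCMField.complexConj L) 3 H).Adelic, k ∈ cmCompactFactor L ι H T hT →
          ∀ v : P.space.toSubmodule, (adelicGroupData (↥(maximalRealSubfield L)) L (IsCMField.complexConj L) 3 H).rightRegular μ k
            (v : (adelicGroupData (↥(maximalRealSubfield L)) L (IsCMField.complexConj L) 3 H).L2 μ) = v) →
        ∀ ξ : OneDimAutRepH L,
          MemXiFamily P (transpose_map_cmConjRingHom_eq_of_frame L ι H T hT) (isUnit_det_of_frame L ι H T hT) μω hμu ξ →
            ∀ τ : L →+* ℂ, InfinitePlace.mk τ ≠ InfinitePlace.mk ι →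
              ξ.IsCohTrivialAt (ArchSignRecipe.tOfArchType (archTypeOfRecord μω) τ) τ := by
  intro L _ _ _ ι H T hT hdef h2 μ _ μω hμu hμω P hP hKc ξ hmem τ hτ
  -- S2♯'s missing hypothesis: a cotangent `P` carries a `(𝔤,K)`-token of some type `δ = ±1` at `ι` (★ `exists_cohToken_of_isHolOrAntihol_cpt`)
  obtain ⟨M, _, _, σK, σ𝔤, hM, δ, hδ, hirr, htok, hne⟩ := exists_cohToken_of_isHolOrAntihol_cpt L ι H T hT μ hdef h2 P hP
  obtain ⟨ξ₀, hmem₀, hall⟩ := h L ι H T hT hdef h2 μ μω hμu hμω P hP hKc M σK σ𝔤 hM hirr htok δ hδ hne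
  -- the given `ξ` of the family IS S2♯'s `ξ₀` (U♭ on the cotangent locus, ★ p847744)
  have hξ : ξ = ξ₀ := memXiFamily_rigid_of_isCot ι H T hT hdef h2 μω hμu P hP ξ ξ₀ hmem hmem₀
  rw [hξ]
  exact hall (archTypeOfRecord μω) (hasUnitaryArchType_archTypeOfRecord μω hμu hμω) τ

/-! ## §4 FIN ⟹ PIN-ι ⟹ PIN-τ ⟹ S2♯ (the Theorems-side twin of the skeleton's head `stub_S2sharp_of_organs`) -/

/-- **ORGANS ⟹ S2♯** (the skeleton's head, same proof, under `Theorems/` so that the hypothesis-free carrier can be assembled below the closer the day the three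
organs are ★): the `ξ` of FIN; for a unitary type `k` of `μω`, `k = k₀` (★ `archTypeOfRecord_eq`) with every `k w` odd (★ `odd_archTypeOfRecord`); an embedding `ι′`
over `ι` is `ι` or `ῑ` — PIN-ι at `ι` and ★ `isCohTrivialAt_of_mk_eq` (`t ↦ −t−1`); an embedding off `ι` is compact — PIN-τ.
[cite: Rogawski1990, §14.6 Thm. 14.6.4 (p. 243); Prop. 15.2.1 (b) (p. 249); §12.3 pp. 174–178; §14.6 pp. 242–243] [cite: Liu2021, Remark 4.2] -/
theorem s2sharp_of_organs
    (hFin :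
      ∀ (L : Type) [Field L] [NumberField L] [IsCMField L] (ι : L →+* ℂ) (H : Matrix (Fin 3) (Fin 3) L) (T : GL (Fin 3) ℂ)
        (hT : (T : Matrix (Fin 3) (Fin 3) ℂ)ᴴ * H.map ι * (T : Matrix (Fin 3) (Fin 3) ℂ) = Literature.Geometry.ComplexHyperbolic.BallModel.J),
        (∀ τ' : L →+* ℂ, InfinitePlace.mk τ' ≠ InfinitePlace.mk ι → (H.map τ').PosDef) →
        2 ≤ Module.finrank ℚ ↥(maximalRealSubfield L) →
        ∀ (μ : Measure (adelicGroupData (↥(maximalRealSubfield L)) L (IsCMField.complexConj L) 3 H).automorphicQuotient)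
          [(adelicGroupData (↥(maximalRealSubfield L)) L (IsCMField.complexConj L) 3 H).IsAutomorphicMeasure μ]
          (μω : HeckeCharacter L) (hμu : μω.IsUnitary),
          (∀ x : Literature.NumberTheory.GaloisRepresentations.ideleGroup ↥(maximalRealSubfield L),
            μω (AdeleRing.ideleBaseChange (↥(maximalRealSubfield L)) L x) = quadraticHeckeCharCM L x) →
        ∀ (P : DiscreteAutomorphicRep (adelicGroupData (↥(maximalRealSubfield L)) L (IsCMField.complexConj L) 3 H) μ),
          (P.IsHolCotangentAt (cmArchSection L ι H T hT) (cmCompactFactor L ι H T hT) ∨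
            P.IsAntiholCotangentAt (cmArchSection L ι H T hT) (cmCompactFactor L ι H T hT)) →
          (∀ k : (adelicGroupData (↥(maximalRealSubfield L)) L (IsCMField.complexConj L) 3 H).Adelic, k ∈ cmCompactFactor L ι H T hT →
            ∀ v : P.space.toSubmodule, (adelicGroupData (↥(maximalRealSubfield L)) L (IsCMField.complexConj L) 3 H).rightRegular μ k
              (v : (adelicGroupData (↥(maximalRealSubfield L)) L (IsCMField.complexConj L) 3 H).L2 μ) = v) →
          ∀ (M : Type) [AddCommGroup M] [Module ℂ M]
            (σK : Representation ℂ (uFormGroup (Fin 2) (Fin 1)).maximalCompact M) (σ𝔤 : (uFormGroup (Fin 2) (Fin 1)).lie →ₗ⁅ℝ⁆ Module.End ℂ M)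
            (hM : IsGKModule (uFormGroup (Fin 2) (Fin 1)) σK σ𝔤), IsIrreducibleGK σK σ𝔤 →
            (∃ T₁ : P.archModuleCM ι T hT →ₗ[ℂ] M,
              (∀ (k : (uFormGroup (Fin 2) (Fin 1)).maximalCompact) (w : P.archModuleCM ι T hT), T₁ (P.archRepKCM ι T hT k w) = σK k (T₁ w)) ∧
                (∀ (X : (uFormGroup (Fin 2) (Fin 1)).lie) (w : P.archModuleCM ι T hT), T₁ (P.archRepLieCM ι T hT X w) = σ𝔤 X (T₁ w)) ∧ T₁ ≠ 0) →
            ∀ δ : ℤ, (δ = 1 ∨ δ = -1) → upqTypeClasses σK σ𝔤 hM.ad_compat 1 δ ≠ ⊥ →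
              ∃ ξ : OneDimAutRepH L,
                MemXiFamily P (transpose_map_cmConjRingHom_eq_of_frame L ι H T hT) (isUnit_det_of_frame L ι H T hT) μω hμu ξ)
    (hIota :
      ∀ (L : Type) [Field L] [NumberField L] [IsCMField L] (ι : L →+* ℂ) (H : Matrix (Fin 3) (Fin 3) L) (T : GL (Fin 3) ℂ)
        (hT : (T : Matrix (Fin 3) (Fin 3) ℂ)ᴴ * H.map ι * (T : Matrix (Fin 3) (Fin 3) ℂ) = Literature.Geometry.ComplexHyperbolic.BallModel.J),
        (∀ τ' : L →+* ℂ, InfinitePlace.mk τ' ≠ InfinitePlace.mk ι → (H.map τ').PosDef) →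
        2 ≤ Module.finrank ℚ ↥(maximalRealSubfield L) →
        ∀ (μ : Measure (adelicGroupData (↥(maximalRealSubfield L)) L (IsCMField.complexConj L) 3 H).automorphicQuotient)
          [(adelicGroupData (↥(maximalRealSubfield L)) L (IsCMField.complexConj L) 3 H).IsAutomorphicMeasure μ]
          (μω : HeckeCharacter L) (hμu : μω.IsUnitary),
          (∀ x : Literature.NumberTheory.GaloisRepresentations.ideleGroup ↥(maximalRealSubfield L),
            μω (AdeleRing.ideleBaseChange (↥(maximalRealSubfield L)) L x) = quadraticHeckeCharCM L x) →
        ∀ (P : DiscreteAutomorphicRep (adelicGroupData (↥(maximalRealSubfield L)) L (IsCMField.complexConj L) 3 H) μ),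
          (P.IsHolCotangentAt (cmArchSection L ι H T hT) (cmCompactFactor L ι H T hT) ∨
            P.IsAntiholCotangentAt (cmArchSection L ι H T hT) (cmCompactFactor L ι H T hT)) →
          ∀ (M : Type) [AddCommGroup M] [Module ℂ M]
            (σK : Representation ℂ (uFormGroup (Fin 2) (Fin 1)).maximalCompact M) (σ𝔤 : (uFormGroup (Fin 2) (Fin 1)).lie →ₗ⁅ℝ⁆ Module.End ℂ M)
            (hM : IsGKModule (uFormGroup (Fin 2) (Fin 1)) σK σ𝔤), IsIrreducibleGK σK σ𝔤 →
            (∃ T₁ : P.archModuleCM ι T hT →ₗ[ℂ] M,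
              (∀ (k : (uFormGroup (Fin 2) (Fin 1)).maximalCompact) (w : P.archModuleCM ι T hT), T₁ (P.archRepKCM ι T hT k w) = σK k (T₁ w)) ∧
                (∀ (X : (uFormGroup (Fin 2) (Fin 1)).lie) (w : P.archModuleCM ι T hT), T₁ (P.archRepLieCM ι T hT X w) = σ𝔤 X (T₁ w)) ∧ T₁ ≠ 0) →
            ∀ δ : ℤ, (δ = 1 ∨ δ = -1) → upqTypeClasses σK σ𝔤 hM.ad_compat 1 δ ≠ ⊥ →
              ∀ ξ : OneDimAutRepH L,
                MemXiFamily P (transpose_map_cmConjRingHom_eq_of_frame L ι H T hT) (isUnit_det_of_frame L ι H T hT) μω hμu ξ →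
                  ξ.IsCohTrivialAt (ArchSignRecipe.tOfArchType (archTypeOfRecord μω) ι) ι)
    (hCpt :
      ∀ (L : Type) [Field L] [NumberField L] [IsCMField L] (ι : L →+* ℂ) (H : Matrix (Fin 3) (Fin 3) L) (T : GL (Fin 3) ℂ)
        (hT : (T : Matrix (Fin 3) (Fin 3) ℂ)ᴴ * H.map ι * (T : Matrix (Fin 3) (Fin 3) ℂ) = Literature.Geometry.ComplexHyperbolic.BallModel.J),
        (∀ τ' : L →+* ℂ, InfinitePlace.mk τ' ≠ InfinitePlace.mk ι → (H.map τ').PosDef) →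
        2 ≤ Module.finrank ℚ ↥(maximalRealSubfield L) →
        ∀ (μ : Measure (adelicGroupData (↥(maximalRealSubfield L)) L (IsCMField.complexConj L) 3 H).automorphicQuotient)
          [(adelicGroupData (↥(maximalRealSubfield L)) L (IsCMField.complexConj L) 3 H).IsAutomorphicMeasure μ]
          (μω : HeckeCharacter L) (hμu : μω.IsUnitary),
          (∀ x : Literature.NumberTheory.GaloisRepresentations.ideleGroup ↥(maximalRealSubfield L),
            μω (AdeleRing.ideleBaseChange (↥(maximalRealSubfield L)) L x) = quadraticHeckeCharCM L x) →
        ∀ (P : DiscreteAutomorphicRep (adelicGroupData (↥(maximalRealSubfield L)) L (IsCMField.complexConj L) 3 H) μ),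
          (P.IsHolCotangentAt (cmArchSection L ι H T hT) (cmCompactFactor L ι H T hT) ∨
            P.IsAntiholCotangentAt (cmArchSection L ι H T hT) (cmCompactFactor L ι H T hT)) →
          (∀ k : (adelicGroupData (↥(maximalRealSubfield L)) L (IsCMField.complexConj L) 3 H).Adelic, k ∈ cmCompactFactor L ι H T hT →
            ∀ v : P.space.toSubmodule, (adelicGroupData (↥(maximalRealSubfield L)) L (IsCMField.complexConj L) 3 H).rightRegular μ k
              (v : (adelicGroupData (↥(maximalRealSubfield L)) L (IsCMField.complexConj L) 3 H).L2 μ) = v) →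
          ∀ ξ : OneDimAutRepH L,
            MemXiFamily P (transpose_map_cmConjRingHom_eq_of_frame L ι H T hT) (isUnit_det_of_frame L ι H T hT) μω hμu ξ →
              ∀ τ : L →+* ℂ, InfinitePlace.mk τ ≠ InfinitePlace.mk ι →
                ξ.IsCohTrivialAt (ArchSignRecipe.tOfArchType (archTypeOfRecord μω) τ) τ) :
    Literature.NumberTheory.Rogawski1990.cohDiscrete_memXiFamily_archPinned := by
  intro L _ _ _ ι H T hT hdef h2 μ _ μω hμu hμω P hP hKc M _ _ σK σ𝔤 hM hirr htok δ hδ hne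
  obtain ⟨ξ, hmem⟩ := hFin L ι H T hT hdef h2 μ μω hμu hμω P hP hKc M σK σ𝔤 hM hirr htok δ hδ hne
  refine ⟨ξ, hmem, fun k hk ι' => ?_⟩
  have hk₀ : archTypeOfRecord μω = k := archTypeOfRecord_eq hμu hk
  have hodd : ∀ w : InfinitePlace L, Odd (k w) := fun w => hk₀ ▸ odd_archTypeOfRecord μω hμu hμω w
  by_cases hι' : InfinitePlace.mk ι' = InfinitePlace.mk ι
  · -- over the place of `ι`: PIN-ι at `ι`, transported to `ι′ ∈ {ι, ῑ}`
    have hι : ξ.IsCohTrivialAt (ArchSignRecipe.tOfArchType k ι) ι := by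
      have h := hIota L ι H T hT hdef h2 μ μω hμu hμω P hP M σK σ𝔤 hM hirr htok δ hδ hne ξ hmem
      rwa [hk₀] at h
    exact isCohTrivialAt_of_mk_eq ξ k hodd ι hι ι' hι'
  · -- a compact embedding: PIN-τ
    have h := hCpt L ι H T hT hdef h2 μ μω hμu hμω P hP hKc ξ hmem ι' hι'
    rwa [hk₀] at h

/-! ## §5 THE CERTIFICATE: S2♯ ↔ FIN ∧ PIN-ι ∧ PIN-τ -/

/-- **THE EQUIVALENCE CERTIFICATE** — the print letter #80 S2♯ ★ `cohDiscrete_memXiFamily_archPinned` is EQUIVALENT to the conjunction of the LH1 skeleton's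
three organs FIN ∧ PIN-ι ∧ PIN-τ (texts token for token), modulo the in-house ★ facts of §2–§3 (`K_c`-triviality and the `(𝔤,K)`-token of a cotangent `P`,
U♭ on the cotangent locus, the unitary archimedean type of record of `μω`): the books may read row III-26 (#80) as the partition FIN + PIN-ι + PIN-τ.
[cite: Rogawski1990, §14.6 Thm. 14.6.4 (p. 243) and pp. 242–243; Prop. 15.2.1 (a)(b) (p. 249); §12.3 pp. 174–178; Thm. 13.3.5 and Thm. 13.3.6 (c) (p. 202); §13.1 p. 199]
[cite: BorelWallach2000, VI Thm. 4.11] [cite: Zelevinsky1980, Thm. 4.2] [cite: Liu2021, Remark 4.2] -/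
theorem s2sharp_iff_organs :
    Literature.NumberTheory.Rogawski1990.cohDiscrete_memXiFamily_archPinned ↔
      (∀ (L : Type) [Field L] [NumberField L] [IsCMField L] (ι : L →+* ℂ) (H : Matrix (Fin 3) (Fin 3) L) (T : GL (Fin 3) ℂ)
        (hT : (T : Matrix (Fin 3) (Fin 3) ℂ)ᴴ * H.map ι * (T : Matrix (Fin 3) (Fin 3) ℂ) = Literature.Geometry.ComplexHyperbolic.BallModel.J),
        (∀ τ' : L →+* ℂ, InfinitePlace.mk τ' ≠ InfinitePlace.mk ι → (H.map τ').PosDef) →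
        2 ≤ Module.finrank ℚ ↥(maximalRealSubfield L) →
        ∀ (μ : Measure (adelicGroupData (↥(maximalRealSubfield L)) L (IsCMField.complexConj L) 3 H).automorphicQuotient)
          [(adelicGroupData (↥(maximalRealSubfield L)) L (IsCMField.complexConj L) 3 H).IsAutomorphicMeasure μ]
          (μω : HeckeCharacter L) (hμu : μω.IsUnitary),
          (∀ x : Literature.NumberTheory.GaloisRepresentations.ideleGroup ↥(maximalRealSubfield L),
            μω (AdeleRing.ideleBaseChange (↥(maximalRealSubfield L)) L x) = quadraticHeckeCharCM L x) →
        ∀ (P : DiscreteAutomorphicRep (adelicGroupData (↥(maximalRealSubfield L)) L (IsCMField.complexConj L) 3 H) μ),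
          (P.IsHolCotangentAt (cmArchSection L ι H T hT) (cmCompactFactor L ι H T hT) ∨
            P.IsAntiholCotangentAt (cmArchSection L ι H T hT) (cmCompactFactor L ι H T hT)) →
          (∀ k : (adelicGroupData (↥(maximalRealSubfield L)) L (IsCMField.complexConj L) 3 H).Adelic, k ∈ cmCompactFactor L ι H T hT →
            ∀ v : P.space.toSubmodule, (adelicGroupData (↥(maximalRealSubfield L)) L (IsCMField.complexConj L) 3 H).rightRegular μ k
              (v : (adelicGroupData (↥(maximalRealSubfield L)) L (IsCMField.complexConj L) 3 H).L2 μ) = v) →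
          ∀ (M : Type) [AddCommGroup M] [Module ℂ M]
            (σK : Representation ℂ (uFormGroup (Fin 2) (Fin 1)).maximalCompact M) (σ𝔤 : (uFormGroup (Fin 2) (Fin 1)).lie →ₗ⁅ℝ⁆ Module.End ℂ M)
            (hM : IsGKModule (uFormGroup (Fin 2) (Fin 1)) σK σ𝔤), IsIrreducibleGK σK σ𝔤 →
            (∃ T₁ : P.archModuleCM ι T hT →ₗ[ℂ] M,
              (∀ (k : (uFormGroup (Fin 2) (Fin 1)).maximalCompact) (w : P.archModuleCM ι T hT), T₁ (P.archRepKCM ι T hT k w) = σK k (T₁ w)) ∧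
                (∀ (X : (uFormGroup (Fin 2) (Fin 1)).lie) (w : P.archModuleCM ι T hT), T₁ (P.archRepLieCM ι T hT X w) = σ𝔤 X (T₁ w)) ∧ T₁ ≠ 0) →
            ∀ δ : ℤ, (δ = 1 ∨ δ = -1) → upqTypeClasses σK σ𝔤 hM.ad_compat 1 δ ≠ ⊥ →
              ∃ ξ : OneDimAutRepH L,
                MemXiFamily P (transpose_map_cmConjRingHom_eq_of_frame L ι H T hT) (isUnit_det_of_frame L ι H T hT) μω hμu ξ) ∧
      (∀ (L : Type) [Field L] [NumberField L] [IsCMField L] (ι : L →+* ℂ) (H : Matrix (Fin 3) (Fin 3) L) (T : GL (Fin 3) ℂ)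
        (hT : (T : Matrix (Fin 3) (Fin 3) ℂ)ᴴ * H.map ι * (T : Matrix (Fin 3) (Fin 3) ℂ) = Literature.Geometry.ComplexHyperbolic.BallModel.J),
        (∀ τ' : L →+* ℂ, InfinitePlace.mk τ' ≠ InfinitePlace.mk ι → (H.map τ').PosDef) →
        2 ≤ Module.finrank ℚ ↥(maximalRealSubfield L) →
        ∀ (μ : Measure (adelicGroupData (↥(maximalRealSubfield L)) L (IsCMField.complexConj L) 3 H).automorphicQuotient)
          [(adelicGroupData (↥(maximalRealSubfield L)) L (IsCMField.complexConj L) 3 H).IsAutomorphicMeasure μ]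
          (μω : HeckeCharacter L) (hμu : μω.IsUnitary),
          (∀ x : Literature.NumberTheory.GaloisRepresentations.ideleGroup ↥(maximalRealSubfield L),
            μω (AdeleRing.ideleBaseChange (↥(maximalRealSubfield L)) L x) = quadraticHeckeCharCM L x) →
        ∀ (P : DiscreteAutomorphicRep (adelicGroupData (↥(maximalRealSubfield L)) L (IsCMField.complexConj L) 3 H) μ),
          (P.IsHolCotangentAt (cmArchSection L ι H T hT) (cmCompactFactor L ι H T hT) ∨
            P.IsAntiholCotangentAt (cmArchSection L ι H T hT) (cmCompactFactor L ι H T hT)) →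
          ∀ (M : Type) [AddCommGroup M] [Module ℂ M]
            (σK : Representation ℂ (uFormGroup (Fin 2) (Fin 1)).maximalCompact M) (σ𝔤 : (uFormGroup (Fin 2) (Fin 1)).lie →ₗ⁅ℝ⁆ Module.End ℂ M)
            (hM : IsGKModule (uFormGroup (Fin 2) (Fin 1)) σK σ𝔤), IsIrreducibleGK σK σ𝔤 →
            (∃ T₁ : P.archModuleCM ι T hT →ₗ[ℂ] M,
              (∀ (k : (uFormGroup (Fin 2) (Fin 1)).maximalCompact) (w : P.archModuleCM ι T hT), T₁ (P.archRepKCM ι T hT k w) = σK k (T₁ w)) ∧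
                (∀ (X : (uFormGroup (Fin 2) (Fin 1)).lie) (w : P.archModuleCM ι T hT), T₁ (P.archRepLieCM ι T hT X w) = σ𝔤 X (T₁ w)) ∧ T₁ ≠ 0) →
            ∀ δ : ℤ, (δ = 1 ∨ δ = -1) → upqTypeClasses σK σ𝔤 hM.ad_compat 1 δ ≠ ⊥ →
              ∀ ξ : OneDimAutRepH L,
                MemXiFamily P (transpose_map_cmConjRingHom_eq_of_frame L ι H T hT) (isUnit_det_of_frame L ι H T hT) μω hμu ξ →
                  ξ.IsCohTrivialAt (ArchSignRecipe.tOfArchType (archTypeOfRecord μω) ι) ι) ∧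
      (∀ (L : Type) [Field L] [NumberField L] [IsCMField L] (ι : L →+* ℂ) (H : Matrix (Fin 3) (Fin 3) L) (T : GL (Fin 3) ℂ)
        (hT : (T : Matrix (Fin 3) (Fin 3) ℂ)ᴴ * H.map ι * (T : Matrix (Fin 3) (Fin 3) ℂ) = Literature.Geometry.ComplexHyperbolic.BallModel.J),
        (∀ τ' : L →+* ℂ, InfinitePlace.mk τ' ≠ InfinitePlace.mk ι → (H.map τ').PosDef) →
        2 ≤ Module.finrank ℚ ↥(maximalRealSubfield L) →
        ∀ (μ : Measure (adelicGroupData (↥(maximalRealSubfield L)) L (IsCMField.complexConj L) 3 H).automorphicQuotient)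
          [(adelicGroupData (↥(maximalRealSubfield L)) L (IsCMField.complexConj L) 3 H).IsAutomorphicMeasure μ]
          (μω : HeckeCharacter L) (hμu : μω.IsUnitary),
          (∀ x : Literature.NumberTheory.GaloisRepresentations.ideleGroup ↥(maximalRealSubfield L),
            μω (AdeleRing.ideleBaseChange (↥(maximalRealSubfield L)) L x) = quadraticHeckeCharCM L x) →
        ∀ (P : DiscreteAutomorphicRep (adelicGroupData (↥(maximalRealSubfield L)) L (IsCMField.complexConj L) 3 H) μ),
          (P.IsHolCotangentAt (cmArchSection L ι H T hT) (cmCompactFactor L ι H T hT) ∨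
            P.IsAntiholCotangentAt (cmArchSection L ι H T hT) (cmCompactFactor L ι H T hT)) →
          (∀ k : (adelicGroupData (↥(maximalRealSubfield L)) L (IsCMField.complexConj L) 3 H).Adelic, k ∈ cmCompactFactor L ι H T hT →
            ∀ v : P.space.toSubmodule, (adelicGroupData (↥(maximalRealSubfield L)) L (IsCMField.complexConj L) 3 H).rightRegular μ k
              (v : (adelicGroupData (↥(maximalRealSubfield L)) L (IsCMField.complexConj L) 3 H).L2 μ) = v) →
          ∀ ξ : OneDimAutRepH L,
            MemXiFamily P (transpose_map_cmConjRingHom_eq_of_frame L ι H T hT) (isUnit_det_of_frame L ι H T hT) μω hμu ξ →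
              ∀ τ : L →+* ℂ, InfinitePlace.mk τ ≠ InfinitePlace.mk ι →
                ξ.IsCohTrivialAt (ArchSignRecipe.tOfArchType (archTypeOfRecord μω) τ) τ) :=
  ⟨fun h => ⟨s2Fin_of_S2sharp h, s2PinIota_of_S2sharp h, s2PinCompact_of_S2sharp h⟩,
    fun h => s2sharp_of_organs h.1 h.2.1 h.2.2⟩

end Summit.HodgeConjecture.HodgeConjecture.Cruxes.H413.F0P3cS2SharpOrgansOfS2Sharp

end
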